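import Mathlib.Algebra.Group.Commutator
import Mathlib.GroupTheory.Commutator.Basic
import Mathlib.GroupTheory.QuotientGroup.Basic
import Mathlib.Algebra.Group.Subgroup.Pointwise
import Mathlib.Algebra.Group.Subgroup.ZPowers.Lemmas
import Mathlib.Data.Int.GCD
import Mathlib.Data.Nat.Prime.Basic
import Mathlib.Order.Zorn
import Mathlib.Tactic.Group
import HarnessLib

/-!
# Complements modulo a subgroup of prime exponent ([IUTchI] Rmk. 1.2.3 (iv): the "twist" step)

Elementary group theory used by the cell's sub-DAG for [CombGC] Theorem 1.6, row T16-L13 (the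
converse half of the vertex-quotient characterization of [IUTchI] Remark 1.2.3 (iv), kurims p. 42,
file `PSCVertexQuotientConverseProofs.lean`): in a group `Γ`, modulo a normal subgroup `N ⊇ [Γ, Γ]`
containing every `l`-th power (`l` prime) — so that `Γ/N` is an `F_l`-vector space — a subgroup
`H ⊇ N` with `A ⊔ H = ⊤` contains a COMPLEMENT of `A ⊇ N` modulo `N`.  This is the linear algebra
behind "enlarging" a non-maximal elementary abelian quotient in the proof of Rmk. 1.2.3 (iv); it is
done here by Zorn's lemma on subgroups (no module structures):

* `normal_of_commutator_le'` — a subgroup containing `[Γ, Γ]` is normal;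
* `mem_of_pow_mem_of_zpow_mem` — Bezout for a prime exponent;
* `mul_pow_mem_of_commutator_le` — `a ^ l, b ^ l ∈ K ⊇ [Γ, Γ] ⇒ (a b) ^ l ∈ K`;
* `exists_le_sup_eq_top_inf_eq` — the complement.

Proof-only (0 defs); nothing here takes a side on [IUTchIII] Cor. 3.12.
[cite: Mochizuki2012, IUTchI Rmk 1.2.3(iv) p.42]
-/

namespace Literature.AnabelianGeometry.SemiGraphs

namespace PrimeExponent

open scoped Pointwise commutatorElement

variable {Γ : Type*} [Group Γ]

/-- A subgroup containing `[Γ, Γ]` is normal. [cite: Mochizuki2012, IUTchI Rmk 1.2.3(iv) p.42] -/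
theorem normal_of_commutator_le' {M : Subgroup Γ} (h : ⁅(⊤ : Subgroup Γ), ⊤⁆ ≤ M) : M.Normal :=
  ⟨fun n hn g => by
    have key : ⁅g, n⁆ * n = g * n * g⁻¹ := by
      rw [commutatorElement_def]
      group
    rw [← key]
    exact M.mul_mem (h (Subgroup.commutator_mem_commutator (Subgroup.mem_top g)
      (Subgroup.mem_top n))) hn⟩

/-- Bezout for a prime exponent: if `h ^ l ∈ T` and `h ^ k ∈ T` with `l` prime, `l ∤ k`, then
`h ∈ T`. [cite: Mochizuki2012, IUTchI Rmk 1.2.3(iv) p.42] -/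
theorem mem_of_pow_mem_of_zpow_mem {T : Subgroup Γ} {h : Γ} {l : ℕ} (hl : l.Prime) {k : ℤ}
    (hk : ¬ (l : ℤ) ∣ k) (hlT : h ^ l ∈ T) (hkT : h ^ k ∈ T) : h ∈ T := by
  have hg : Int.gcd (l : ℤ) k = 1 := by
    have hdvd : Int.gcd (l : ℤ) k ∣ l := by
      have := Int.gcd_dvd_left (l : ℤ) k
      exact_mod_cast this
    rcases (Nat.dvd_prime hl).mp hdvd with h1 | h2
    · exact h1
    · exact absurd (h2 ▸ Int.gcd_dvd_right (l : ℤ) k) hk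
  have key : ((l : ℤ) * Int.gcdA l k + k * Int.gcdB l k) = 1 := by
    have := Int.gcd_eq_gcd_ab (l : ℤ) k
    rw [hg] at this
    exact_mod_cast this.symm
  have hh : h = (h ^ (l : ℤ)) ^ Int.gcdA l k * (h ^ k) ^ Int.gcdB l k := by
    rw [← zpow_mul, ← zpow_mul, ← zpow_add, key, zpow_one]
  rw [hh]
  exact mul_mem (Subgroup.zpow_mem _ (by rw [zpow_natCast]; exact hlT) _)
    (Subgroup.zpow_mem _ hkT _)

/-- Modulo a subgroup `K ⊇ [Γ, Γ]` the `l`-th power map is multiplicative: `a ^ l, b ^ l ∈ K ⇒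
(a b) ^ l ∈ K`. [cite: Mochizuki2012, IUTchI Rmk 1.2.3(iv) p.42] -/
theorem mul_pow_mem_of_commutator_le {K : Subgroup Γ} (hK : ⁅(⊤ : Subgroup Γ), ⊤⁆ ≤ K) (l : ℕ)
    {a b : Γ} (ha : a ^ l ∈ K) (hb : b ^ l ∈ K) : (a * b) ^ l ∈ K := by
  haveI : K.Normal := normal_of_commutator_le' hK
  haveI : IsMulCommutative (Γ ⧸ K) :=
    Subgroup.Normal.quotient_commutative_iff_commutator_le.mpr (by rwa [commutator_def])
  rw [← QuotientGroup.eq_one_iff] at ha hb ⊢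
  rw [QuotientGroup.mk_pow] at ha hb
  have hc : Commute ((a : Γ ⧸ K)) (b : Γ ⧸ K) := mul_comm' _ _
  rw [QuotientGroup.mk_pow, QuotientGroup.mk_mul, hc.mul_pow, ha, hb, one_mul]

/-- **The twist, as linear algebra over `F_l` done by Zorn's lemma.**  Let `N ⊇ [Γ, Γ]` contain every
`l`-th power (`l` prime), so that `Γ/N` is an `F_l`-vector space, and let `A, H ⊇ N` with
`A ⊔ H = ⊤`.  Then `H` contains a complement of `A` modulo `N`: a subgroup `S` with `N ≤ S ≤ H`,
`A ⊔ S = ⊤`, `A ⊓ S = N` (a subgroup of `H` maximal with `A ⊓ S = N`; if `A ⊔ S ≠ ⊤`, some `h ∈ H`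
lies outside `A ⊔ S`, and `S · ⟨h⟩` is a larger such subgroup since `h ^ l ∈ N`).
[cite: Mochizuki2012, IUTchI Rmk 1.2.3(iv) p.42] -/
theorem exists_le_sup_eq_top_inf_eq {N A H : Subgroup Γ} (hcomm : ⁅(⊤ : Subgroup Γ), ⊤⁆ ≤ N)
    {l : ℕ} (hl : l.Prime) (hpow : ∀ g : Γ, g ^ l ∈ N) (hNA : N ≤ A) (hNH : N ≤ H)
    (hAH : A ⊔ H = ⊤) : ∃ S : Subgroup Γ, N ≤ S ∧ S ≤ H ∧ A ⊔ S = ⊤ ∧ A ⊓ S = N := by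
  classical
  set 𝒮 : Set (Subgroup Γ) := {S | N ≤ S ∧ S ≤ H ∧ A ⊓ S = N} with h𝒮
  have hN𝒮 : N ∈ 𝒮 := ⟨le_rfl, hNH, inf_eq_right.mpr hNA⟩
  -- chains in `𝒮` are bounded by their unions
  have hchain : ∀ c ⊆ 𝒮, IsChain (· ≤ ·) c → ∀ y ∈ c, ∃ ub ∈ 𝒮, ∀ z ∈ c, z ≤ ub := by
    intro c hc𝒮 hc y hy
    refine ⟨sSup c, ⟨(hc𝒮 hy).1.trans (le_sSup hy), sSup_le fun z hz => (hc𝒮 hz).2.1, ?_⟩,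
      fun z hz => le_sSup hz⟩
    refine le_antisymm ?_ (le_inf hNA ((hc𝒮 hy).1.trans (le_sSup hy)))
    rintro x ⟨hxA, hxc⟩
    obtain ⟨s, hs, hxs⟩ := (Subgroup.mem_sSup_of_directedOn ⟨y, hy⟩ hc.directedOn).mp hxc
    have hx : x ∈ A ⊓ s := ⟨hxA, hxs⟩
    rwa [(hc𝒮 hs).2.2] at hx
  obtain ⟨S, hNS, hSmax⟩ := zorn_le_nonempty₀ 𝒮 hchain N hN𝒮
  obtain ⟨-, hSH, hAS⟩ := hSmax.prop
  refine ⟨S, hNS, hSH, ?_, hAS⟩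
  by_contra htop
  -- some `h ∈ H` outside `A ⊔ S`
  have hHle : ¬ H ≤ A ⊔ S := fun hle =>
    htop (top_le_iff.mp (hAH.ge.trans (sup_le le_sup_left hle)))
  obtain ⟨h, hhH, hh⟩ := Set.not_subset.mp hHle
  haveI hSn : S.Normal := normal_of_commutator_le' (hcomm.trans hNS)
  set S' : Subgroup Γ := S ⊔ Subgroup.zpowers h with hS'
  have hS'𝒮 : S' ∈ 𝒮 := by
    refine ⟨hNS.trans le_sup_left, sup_le hSH ((Subgroup.zpowers_le).mpr hhH),
      le_antisymm ?_ (le_inf hNA (hNS.trans le_sup_left))⟩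
    rintro x ⟨hxA, hxS'⟩
    have hx' : x ∈ ((S ⊔ Subgroup.zpowers h : Subgroup Γ) : Set Γ) := hxS'
    rw [Subgroup.normal_mul] at hx'
    obtain ⟨s, hs, t, ht, rfl⟩ := hx'
    obtain ⟨k, rfl⟩ := Subgroup.mem_zpowers_iff.mp ht
    -- `h ^ k ∈ A ⊔ S`
    have hkAS : h ^ k ∈ A ⊔ S := by
      have := mul_mem (Subgroup.mem_sup_right (inv_mem hs) : s⁻¹ ∈ A ⊔ S)
        (Subgroup.mem_sup_left hxA : s * h ^ k ∈ A ⊔ S)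
      rwa [inv_mul_cancel_left] at this
    by_cases hdvd : (l : ℤ) ∣ k
    · obtain ⟨m, rfl⟩ := hdvd
      have hkS : h ^ ((l : ℤ) * m) ∈ S := by
        rw [zpow_mul, zpow_natCast]
        exact Subgroup.zpow_mem _ (hNS (hpow h)) m
      have hx : s * h ^ ((l : ℤ) * m) ∈ A ⊓ S := ⟨hxA, mul_mem hs hkS⟩
      rwa [hAS] at hx
    · exact absurd (mem_of_pow_mem_of_zpow_mem hl hdvd
        (Subgroup.mem_sup_right (hNS (hpow h))) hkAS) hh
  have hEq : S = S' := hSmax.eq_of_le hS'𝒮 le_sup_left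
  apply hh
  have hhS' : h ∈ S' := Subgroup.mem_sup_right (Subgroup.mem_zpowers h)
  rw [← hEq] at hhS'
  exact Subgroup.mem_sup_right hhS'


end PrimeExponent

end Literature.AnabelianGeometry.SemiGraphs
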